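import Summits.BirchSwinnertonDyer.Rank1Residual.P2.CongruentNumberPairsAtTwoEven
import Literature.NumberTheory.EllipticCurves.CongruentNumberMonskySelmerRankZero
import HarnessLib

/-!
# Sub-lane «bsd-p2» / cell `bsd-monsky`: the even `s(n) = 0` PAIRS WITHOUT Monsky's named fact —
# `#Sel₂(E_n) = 4` (hence rank `0` and `Ш(E_n)[2^∞] = 0`) UNCONDITIONALLY for the 12 even `n ∈ U_CN` with `det M = 1`,
# and `BSD(E_n, 2)` for them modulo the three JOURNAL facts {Burungale–Tian, Deuring–Hecke, Burungale–Flach} ONLY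

HONEST FRAMING (sub-lane «bsd-p2», run/shared/lean/b2b/bsd-rank1-residual/p2/; cell `bsd-monsky`, run/shared/lean/pub/bsd-monsky/): the
target of record is the FULL Birch–Swinnerton-Dyer formula for EVERY analytic-rank `≤ 1` `E/ℚ` at ALL primes INCLUDING `2`; the `2`-part is
under census. The landed instance file `P2/CongruentNumberPairsAtTwoEven.lean` (even `n ∈ {2, 10, 26, 42, 58, 66, 74, 106, 114, 122, 130, 170}`) closes `BSD(E_n, 2)` on the JOURNAL
door modulo FOUR named facts: Monsky's `2`-descent matrix theorem `hM` (even case, `n = 2p₁⋯p_k`) + `hBT` + `hH` + `hBF`, the census membership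
`s(n) = 0` being the kernel-decided `det M = 1` (`det_monskyMatrixEven_n` there). The tree now PROVES the upper-bound half of Monsky's formula
(`Literature/…/CongruentNumberEvenMonskySelmerBound.lean`) and hence, fact-free, `det M = 1 ⟹ #Sel₂(E_n) = 4 ⟹ rk E_n(ℚ) = 0 ∧ Ш(E_n)[2^∞] = 0`
(`Literature/…/CongruentNumberMonskySelmerRankZero.lean`). THIS FILE re-runs the instance file on that: §1 the door with `hM` struck
(`bsdp_two_congruentNumberCurve_of_det_even_descent`, journal facts only; modularity-leaf variant `'`); §2 per-`n` instances
`card_selmerGroup_two_congruentNumberCurve_n` (UNCONDITIONAL) / `bsdp_two_congruentNumberCurve_n_descent` and the ROLL-UPS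
**`card_selmerGroup_two_eq_four_of_mem_evenList`, `rank_zero_sha_two_of_mem_evenList` — UNCONDITIONAL** (rank `0` and `Ш[2^∞] = 0` for these
12 curves with NO named fact) and `bsdp_two_congruentNumberCurve_of_mem_evenList_descent` (modulo {`hBT`, `hH`, `hBF`} ONLY). Companion: `…OddDescent.lean`.
Nothing booked by this file; the lane's marks and the PARTITION are the lead's / director's business.

References: [HeathBrown1994SelmerCongruentII] Appendix (Monsky), typescript p. 41 L20–L36; [SilvermanAEC2009] Thm. X.4.2; [BurungaleTian2026] Thm. 1.1;
[BurungaleFlach2024] Thm. 1.1, Cor. 2; [BCDTJAMS2001] Theorem A; [Miller2011LMS] Def. 1.1.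
-/

noncomputable section

open scoped Classical

open Matrix Finset WeierstrassCurve Literature.NumberTheory.EllipticCurves
  Literature.NumberTheory.EllipticCurves.Rank1Residual
  Literature.NumberTheory.EllipticCurves.Rank1Residual.Typed
  Literature.NumberTheory.EllipticCurves.HeathBrown1994
  Literature.NumberTheory.EllipticCurves.CongruentNumberMonskySelmer

set_option autoImplicit false

namespace Summit.BirchSwinnertonDyer.Rank1Residual.P2

/-! ## §1 The `det M = 1` door (even `n`) with Monsky's fact struck -/

section Doors

variable {k : ℕ} (p : Fin k → ℕ)

/-- **JOURNAL door, even `n = 2p₁⋯p_k`, WITHOUT Monsky's fact**: `det M = 1` + {`hBT`, `hH`, `hBF`} ⟹ `BSD(E_n, 2)`.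
[cite: HeathBrown1994SelmerCongruentII, Appendix (Monsky), typescript p. 41 L20–L36] [cite: BurungaleTian2026, Thm. 1.1]
[cite: BurungaleFlach2024, Thm. 1.1 and Cor. 2] [cite: Miller2011LMS, Def. 1.1] -/
theorem bsdp_two_congruentNumberCurve_of_det_even_descent
    (hBT : burungaleTian_analyticRank_eq_zero_of_selmerCorank_eq_zero_of_hasCM)
    (hH : hasEntireLFunction_of_j_mem_maximalCMJInvariants) (hBF : bsdTriple_of_hasCM_of_L_one_ne_zero)
    (hp : ∀ i, (p i).Prime) (hodd : ∀ i, Odd (p i)) (hinj : Function.Injective p)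
    (hdet : (monskyMatrixEven p).det = 1) {n : ℕ} (hn : 2 * ∏ i, p i = n) :
    BSDp (congruentNumberCurve n) 2 := by
  subst hn
  exact forall_bsdp_of_BT_BF_even_descent p hBT hH hBF hp hodd hinj hdet 2 Nat.prime_two

/-- The journal door with the MODULARITY leaf (`hasEntireLFunction_rat`), even `n`, WITHOUT Monsky's fact. [cite: BurungaleTian2026, Thm. 1.1]
[cite: BurungaleFlach2024, Cor. 2] [cite: BCDTJAMS2001, Theorem A] -/
theorem bsdp_two_congruentNumberCurve_of_det_even_descent'
    (hBT : burungaleTian_analyticRank_eq_zero_of_selmerCorank_eq_zero_of_hasCM)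
    (hmod : hasEntireLFunction_rat) (hBF : bsdTriple_of_hasCM_of_L_one_ne_zero)
    (hp : ∀ i, (p i).Prime) (hodd : ∀ i, Odd (p i)) (hinj : Function.Injective p)
    (hdet : (monskyMatrixEven p).det = 1) {n : ℕ} (hn : 2 * ∏ i, p i = n) :
    BSDp (congruentNumberCurve n) 2 :=
  bsdp_two_congruentNumberCurve_of_det_even_descent p hBT
    (hasEntireLFunction_of_j_mem_maximalCMJInvariants_of_hasEntireLFunction_rat hmod) hBF hp hodd hinj hdet hn

end Doors

/-! ## §2 The 12 instances: `#Sel₂(E_n) = 4` unconditionally; `BSD(E_n, 2)` modulo the journal facts only -/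

section Instances

/-- **`#Sel⁽²⁾(E_{2}/ℚ) = 4` — UNCONDITIONAL** (`det M = 1` for `n = 2`, `det_monskyMatrixEven_2`; hence rank `0`, `Ш[2^∞] = 0`).
[cite: HeathBrown1994SelmerCongruentII, Appendix (Monsky), typescript p. 41 L20–L36] [cite: SilvermanAEC2009, Thm. X.4.2] -/
theorem card_selmerGroup_two_congruentNumberCurve_2 : Nat.card ((congruentNumberCurve 2).selmerGroup 2) = 4 :=
  card_selmerGroup_two_eq_four_of_det_even' (![] : Fin 0 → ℕ) (by simp) (fun i => i.elim0) (fun i => i.elim0) (Function.injective_of_subsingleton _) det_monskyMatrixEven_2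

/-- **`BSD(E_{2}, 2)` WITHOUT Monsky's fact** — journal door {`hBT`, `hH`, `hBF`} only; membership `s(2) = 0` by `det_monskyMatrixEven_2`.
[cite: BurungaleTian2026, Thm. 1.1] [cite: BurungaleFlach2024, Cor. 2] [cite: Miller2011LMS, Def. 1.1] -/
theorem bsdp_two_congruentNumberCurve_2_descent
    (hBT : burungaleTian_analyticRank_eq_zero_of_selmerCorank_eq_zero_of_hasCM)
    (hH : hasEntireLFunction_of_j_mem_maximalCMJInvariants) (hBF : bsdTriple_of_hasCM_of_L_one_ne_zero) :
    BSDp (congruentNumberCurve 2) 2 :=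
  bsdp_two_congruentNumberCurve_of_det_even_descent (![] : Fin 0 → ℕ) hBT hH hBF (fun i => i.elim0) (fun i => i.elim0) (Function.injective_of_subsingleton _) det_monskyMatrixEven_2 (by simp)

/-- **`#Sel⁽²⁾(E_{10}/ℚ) = 4` — UNCONDITIONAL** (`det M = 1` for `n = 10`, `det_monskyMatrixEven_10`; hence rank `0`, `Ш[2^∞] = 0`).
[cite: HeathBrown1994SelmerCongruentII, Appendix (Monsky), typescript p. 41 L20–L36] [cite: SilvermanAEC2009, Thm. X.4.2] -/
theorem card_selmerGroup_two_congruentNumberCurve_10 : Nat.card ((congruentNumberCurve 10).selmerGroup 2) = 4 :=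
  card_selmerGroup_two_eq_four_of_det_even' ![5] (by simp) (by intro i; fin_cases i; norm_num) (by intro i; fin_cases i; decide) (by decide) det_monskyMatrixEven_10

/-- **`BSD(E_{10}, 2)` WITHOUT Monsky's fact** — journal door {`hBT`, `hH`, `hBF`} only; membership `s(10) = 0` by `det_monskyMatrixEven_10`.
[cite: BurungaleTian2026, Thm. 1.1] [cite: BurungaleFlach2024, Cor. 2] [cite: Miller2011LMS, Def. 1.1] -/
theorem bsdp_two_congruentNumberCurve_10_descent
    (hBT : burungaleTian_analyticRank_eq_zero_of_selmerCorank_eq_zero_of_hasCM)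
    (hH : hasEntireLFunction_of_j_mem_maximalCMJInvariants) (hBF : bsdTriple_of_hasCM_of_L_one_ne_zero) :
    BSDp (congruentNumberCurve 10) 2 :=
  bsdp_two_congruentNumberCurve_of_det_even_descent ![5] hBT hH hBF (by intro i; fin_cases i; norm_num) (by intro i; fin_cases i; decide) (by decide) det_monskyMatrixEven_10 (by simp)

/-- **`#Sel⁽²⁾(E_{26}/ℚ) = 4` — UNCONDITIONAL** (`det M = 1` for `n = 26`, `det_monskyMatrixEven_26`; hence rank `0`, `Ш[2^∞] = 0`).
[cite: HeathBrown1994SelmerCongruentII, Appendix (Monsky), typescript p. 41 L20–L36] [cite: SilvermanAEC2009, Thm. X.4.2] -/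
theorem card_selmerGroup_two_congruentNumberCurve_26 : Nat.card ((congruentNumberCurve 26).selmerGroup 2) = 4 :=
  card_selmerGroup_two_eq_four_of_det_even' ![13] (by simp) (by intro i; fin_cases i; norm_num) (by intro i; fin_cases i; decide) (by decide) det_monskyMatrixEven_26

/-- **`BSD(E_{26}, 2)` WITHOUT Monsky's fact** — journal door {`hBT`, `hH`, `hBF`} only; membership `s(26) = 0` by `det_monskyMatrixEven_26`.
[cite: BurungaleTian2026, Thm. 1.1] [cite: BurungaleFlach2024, Cor. 2] [cite: Miller2011LMS, Def. 1.1] -/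
theorem bsdp_two_congruentNumberCurve_26_descent
    (hBT : burungaleTian_analyticRank_eq_zero_of_selmerCorank_eq_zero_of_hasCM)
    (hH : hasEntireLFunction_of_j_mem_maximalCMJInvariants) (hBF : bsdTriple_of_hasCM_of_L_one_ne_zero) :
    BSDp (congruentNumberCurve 26) 2 :=
  bsdp_two_congruentNumberCurve_of_det_even_descent ![13] hBT hH hBF (by intro i; fin_cases i; norm_num) (by intro i; fin_cases i; decide) (by decide) det_monskyMatrixEven_26 (by simp)

/-- **`#Sel⁽²⁾(E_{42}/ℚ) = 4` — UNCONDITIONAL** (`det M = 1` for `n = 42`, `det_monskyMatrixEven_42`; hence rank `0`, `Ш[2^∞] = 0`).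
[cite: HeathBrown1994SelmerCongruentII, Appendix (Monsky), typescript p. 41 L20–L36] [cite: SilvermanAEC2009, Thm. X.4.2] -/
theorem card_selmerGroup_two_congruentNumberCurve_42 : Nat.card ((congruentNumberCurve 42).selmerGroup 2) = 4 :=
  card_selmerGroup_two_eq_four_of_det_even' ![3, 7] (by simp [Fin.prod_univ_succ]) (by intro i; fin_cases i <;> norm_num) (by intro i; fin_cases i <;> decide) (by decide) det_monskyMatrixEven_42

/-- **`BSD(E_{42}, 2)` WITHOUT Monsky's fact** — journal door {`hBT`, `hH`, `hBF`} only; membership `s(42) = 0` by `det_monskyMatrixEven_42`.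
[cite: BurungaleTian2026, Thm. 1.1] [cite: BurungaleFlach2024, Cor. 2] [cite: Miller2011LMS, Def. 1.1] -/
theorem bsdp_two_congruentNumberCurve_42_descent
    (hBT : burungaleTian_analyticRank_eq_zero_of_selmerCorank_eq_zero_of_hasCM)
    (hH : hasEntireLFunction_of_j_mem_maximalCMJInvariants) (hBF : bsdTriple_of_hasCM_of_L_one_ne_zero) :
    BSDp (congruentNumberCurve 42) 2 :=
  bsdp_two_congruentNumberCurve_of_det_even_descent ![3, 7] hBT hH hBF (by intro i; fin_cases i <;> norm_num) (by intro i; fin_cases i <;> decide) (by decide) det_monskyMatrixEven_42 (by simp [Fin.prod_univ_succ])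

/-- **`#Sel⁽²⁾(E_{58}/ℚ) = 4` — UNCONDITIONAL** (`det M = 1` for `n = 58`, `det_monskyMatrixEven_58`; hence rank `0`, `Ш[2^∞] = 0`).
[cite: HeathBrown1994SelmerCongruentII, Appendix (Monsky), typescript p. 41 L20–L36] [cite: SilvermanAEC2009, Thm. X.4.2] -/
theorem card_selmerGroup_two_congruentNumberCurve_58 : Nat.card ((congruentNumberCurve 58).selmerGroup 2) = 4 :=
  card_selmerGroup_two_eq_four_of_det_even' ![29] (by simp) (by intro i; fin_cases i; norm_num) (by intro i; fin_cases i; decide) (by decide) det_monskyMatrixEven_58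

/-- **`BSD(E_{58}, 2)` WITHOUT Monsky's fact** — journal door {`hBT`, `hH`, `hBF`} only; membership `s(58) = 0` by `det_monskyMatrixEven_58`.
[cite: BurungaleTian2026, Thm. 1.1] [cite: BurungaleFlach2024, Cor. 2] [cite: Miller2011LMS, Def. 1.1] -/
theorem bsdp_two_congruentNumberCurve_58_descent
    (hBT : burungaleTian_analyticRank_eq_zero_of_selmerCorank_eq_zero_of_hasCM)
    (hH : hasEntireLFunction_of_j_mem_maximalCMJInvariants) (hBF : bsdTriple_of_hasCM_of_L_one_ne_zero) :
    BSDp (congruentNumberCurve 58) 2 :=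
  bsdp_two_congruentNumberCurve_of_det_even_descent ![29] hBT hH hBF (by intro i; fin_cases i; norm_num) (by intro i; fin_cases i; decide) (by decide) det_monskyMatrixEven_58 (by simp)

/-- **`#Sel⁽²⁾(E_{66}/ℚ) = 4` — UNCONDITIONAL** (`det M = 1` for `n = 66`, `det_monskyMatrixEven_66`; hence rank `0`, `Ш[2^∞] = 0`).
[cite: HeathBrown1994SelmerCongruentII, Appendix (Monsky), typescript p. 41 L20–L36] [cite: SilvermanAEC2009, Thm. X.4.2] -/
theorem card_selmerGroup_two_congruentNumberCurve_66 : Nat.card ((congruentNumberCurve 66).selmerGroup 2) = 4 :=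
  card_selmerGroup_two_eq_four_of_det_even' ![3, 11] (by simp [Fin.prod_univ_succ]) (by intro i; fin_cases i <;> norm_num) (by intro i; fin_cases i <;> decide) (by decide) det_monskyMatrixEven_66

/-- **`BSD(E_{66}, 2)` WITHOUT Monsky's fact** — journal door {`hBT`, `hH`, `hBF`} only; membership `s(66) = 0` by `det_monskyMatrixEven_66`.
[cite: BurungaleTian2026, Thm. 1.1] [cite: BurungaleFlach2024, Cor. 2] [cite: Miller2011LMS, Def. 1.1] -/
theorem bsdp_two_congruentNumberCurve_66_descent
    (hBT : burungaleTian_analyticRank_eq_zero_of_selmerCorank_eq_zero_of_hasCM)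
    (hH : hasEntireLFunction_of_j_mem_maximalCMJInvariants) (hBF : bsdTriple_of_hasCM_of_L_one_ne_zero) :
    BSDp (congruentNumberCurve 66) 2 :=
  bsdp_two_congruentNumberCurve_of_det_even_descent ![3, 11] hBT hH hBF (by intro i; fin_cases i <;> norm_num) (by intro i; fin_cases i <;> decide) (by decide) det_monskyMatrixEven_66 (by simp [Fin.prod_univ_succ])

/-- **`#Sel⁽²⁾(E_{74}/ℚ) = 4` — UNCONDITIONAL** (`det M = 1` for `n = 74`, `det_monskyMatrixEven_74`; hence rank `0`, `Ш[2^∞] = 0`).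
[cite: HeathBrown1994SelmerCongruentII, Appendix (Monsky), typescript p. 41 L20–L36] [cite: SilvermanAEC2009, Thm. X.4.2] -/
theorem card_selmerGroup_two_congruentNumberCurve_74 : Nat.card ((congruentNumberCurve 74).selmerGroup 2) = 4 :=
  card_selmerGroup_two_eq_four_of_det_even' ![37] (by simp) (by intro i; fin_cases i; norm_num) (by intro i; fin_cases i; decide) (by decide) det_monskyMatrixEven_74

/-- **`BSD(E_{74}, 2)` WITHOUT Monsky's fact** — journal door {`hBT`, `hH`, `hBF`} only; membership `s(74) = 0` by `det_monskyMatrixEven_74`.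
[cite: BurungaleTian2026, Thm. 1.1] [cite: BurungaleFlach2024, Cor. 2] [cite: Miller2011LMS, Def. 1.1] -/
theorem bsdp_two_congruentNumberCurve_74_descent
    (hBT : burungaleTian_analyticRank_eq_zero_of_selmerCorank_eq_zero_of_hasCM)
    (hH : hasEntireLFunction_of_j_mem_maximalCMJInvariants) (hBF : bsdTriple_of_hasCM_of_L_one_ne_zero) :
    BSDp (congruentNumberCurve 74) 2 :=
  bsdp_two_congruentNumberCurve_of_det_even_descent ![37] hBT hH hBF (by intro i; fin_cases i; norm_num) (by intro i; fin_cases i; decide) (by decide) det_monskyMatrixEven_74 (by simp)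

/-- **`#Sel⁽²⁾(E_{106}/ℚ) = 4` — UNCONDITIONAL** (`det M = 1` for `n = 106`, `det_monskyMatrixEven_106`; hence rank `0`, `Ш[2^∞] = 0`).
[cite: HeathBrown1994SelmerCongruentII, Appendix (Monsky), typescript p. 41 L20–L36] [cite: SilvermanAEC2009, Thm. X.4.2] -/
theorem card_selmerGroup_two_congruentNumberCurve_106 : Nat.card ((congruentNumberCurve 106).selmerGroup 2) = 4 :=
  card_selmerGroup_two_eq_four_of_det_even' ![53] (by simp) (by intro i; fin_cases i; norm_num) (by intro i; fin_cases i; decide) (by decide) det_monskyMatrixEven_106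

/-- **`BSD(E_{106}, 2)` WITHOUT Monsky's fact** — journal door {`hBT`, `hH`, `hBF`} only; membership `s(106) = 0` by `det_monskyMatrixEven_106`.
[cite: BurungaleTian2026, Thm. 1.1] [cite: BurungaleFlach2024, Cor. 2] [cite: Miller2011LMS, Def. 1.1] -/
theorem bsdp_two_congruentNumberCurve_106_descent
    (hBT : burungaleTian_analyticRank_eq_zero_of_selmerCorank_eq_zero_of_hasCM)
    (hH : hasEntireLFunction_of_j_mem_maximalCMJInvariants) (hBF : bsdTriple_of_hasCM_of_L_one_ne_zero) :
    BSDp (congruentNumberCurve 106) 2 :=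
  bsdp_two_congruentNumberCurve_of_det_even_descent ![53] hBT hH hBF (by intro i; fin_cases i; norm_num) (by intro i; fin_cases i; decide) (by decide) det_monskyMatrixEven_106 (by simp)

/-- **`#Sel⁽²⁾(E_{114}/ℚ) = 4` — UNCONDITIONAL** (`det M = 1` for `n = 114`, `det_monskyMatrixEven_114`; hence rank `0`, `Ш[2^∞] = 0`).
[cite: HeathBrown1994SelmerCongruentII, Appendix (Monsky), typescript p. 41 L20–L36] [cite: SilvermanAEC2009, Thm. X.4.2] -/
theorem card_selmerGroup_two_congruentNumberCurve_114 : Nat.card ((congruentNumberCurve 114).selmerGroup 2) = 4 :=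
  card_selmerGroup_two_eq_four_of_det_even' ![3, 19] (by simp [Fin.prod_univ_succ]) (by intro i; fin_cases i <;> norm_num) (by intro i; fin_cases i <;> decide) (by decide) det_monskyMatrixEven_114

/-- **`BSD(E_{114}, 2)` WITHOUT Monsky's fact** — journal door {`hBT`, `hH`, `hBF`} only; membership `s(114) = 0` by `det_monskyMatrixEven_114`.
[cite: BurungaleTian2026, Thm. 1.1] [cite: BurungaleFlach2024, Cor. 2] [cite: Miller2011LMS, Def. 1.1] -/
theorem bsdp_two_congruentNumberCurve_114_descent
    (hBT : burungaleTian_analyticRank_eq_zero_of_selmerCorank_eq_zero_of_hasCM)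
    (hH : hasEntireLFunction_of_j_mem_maximalCMJInvariants) (hBF : bsdTriple_of_hasCM_of_L_one_ne_zero) :
    BSDp (congruentNumberCurve 114) 2 :=
  bsdp_two_congruentNumberCurve_of_det_even_descent ![3, 19] hBT hH hBF (by intro i; fin_cases i <;> norm_num) (by intro i; fin_cases i <;> decide) (by decide) det_monskyMatrixEven_114 (by simp [Fin.prod_univ_succ])

/-- **`#Sel⁽²⁾(E_{122}/ℚ) = 4` — UNCONDITIONAL** (`det M = 1` for `n = 122`, `det_monskyMatrixEven_122`; hence rank `0`, `Ш[2^∞] = 0`).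
[cite: HeathBrown1994SelmerCongruentII, Appendix (Monsky), typescript p. 41 L20–L36] [cite: SilvermanAEC2009, Thm. X.4.2] -/
theorem card_selmerGroup_two_congruentNumberCurve_122 : Nat.card ((congruentNumberCurve 122).selmerGroup 2) = 4 :=
  card_selmerGroup_two_eq_four_of_det_even' ![61] (by simp) (by intro i; fin_cases i; norm_num) (by intro i; fin_cases i; decide) (by decide) det_monskyMatrixEven_122

/-- **`BSD(E_{122}, 2)` WITHOUT Monsky's fact** — journal door {`hBT`, `hH`, `hBF`} only; membership `s(122) = 0` by `det_monskyMatrixEven_122`.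
[cite: BurungaleTian2026, Thm. 1.1] [cite: BurungaleFlach2024, Cor. 2] [cite: Miller2011LMS, Def. 1.1] -/
theorem bsdp_two_congruentNumberCurve_122_descent
    (hBT : burungaleTian_analyticRank_eq_zero_of_selmerCorank_eq_zero_of_hasCM)
    (hH : hasEntireLFunction_of_j_mem_maximalCMJInvariants) (hBF : bsdTriple_of_hasCM_of_L_one_ne_zero) :
    BSDp (congruentNumberCurve 122) 2 :=
  bsdp_two_congruentNumberCurve_of_det_even_descent ![61] hBT hH hBF (by intro i; fin_cases i; norm_num) (by intro i; fin_cases i; decide) (by decide) det_monskyMatrixEven_122 (by simp)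

/-- **`#Sel⁽²⁾(E_{130}/ℚ) = 4` — UNCONDITIONAL** (`det M = 1` for `n = 130`, `det_monskyMatrixEven_130`; hence rank `0`, `Ш[2^∞] = 0`).
[cite: HeathBrown1994SelmerCongruentII, Appendix (Monsky), typescript p. 41 L20–L36] [cite: SilvermanAEC2009, Thm. X.4.2] -/
theorem card_selmerGroup_two_congruentNumberCurve_130 : Nat.card ((congruentNumberCurve 130).selmerGroup 2) = 4 :=
  card_selmerGroup_two_eq_four_of_det_even' ![5, 13] (by simp [Fin.prod_univ_succ]) (by intro i; fin_cases i <;> norm_num) (by intro i; fin_cases i <;> decide) (by decide) det_monskyMatrixEven_130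

/-- **`BSD(E_{130}, 2)` WITHOUT Monsky's fact** — journal door {`hBT`, `hH`, `hBF`} only; membership `s(130) = 0` by `det_monskyMatrixEven_130`.
[cite: BurungaleTian2026, Thm. 1.1] [cite: BurungaleFlach2024, Cor. 2] [cite: Miller2011LMS, Def. 1.1] -/
theorem bsdp_two_congruentNumberCurve_130_descent
    (hBT : burungaleTian_analyticRank_eq_zero_of_selmerCorank_eq_zero_of_hasCM)
    (hH : hasEntireLFunction_of_j_mem_maximalCMJInvariants) (hBF : bsdTriple_of_hasCM_of_L_one_ne_zero) :
    BSDp (congruentNumberCurve 130) 2 :=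
  bsdp_two_congruentNumberCurve_of_det_even_descent ![5, 13] hBT hH hBF (by intro i; fin_cases i <;> norm_num) (by intro i; fin_cases i <;> decide) (by decide) det_monskyMatrixEven_130 (by simp [Fin.prod_univ_succ])

/-- **`#Sel⁽²⁾(E_{170}/ℚ) = 4` — UNCONDITIONAL** (`det M = 1` for `n = 170`, `det_monskyMatrixEven_170`; hence rank `0`, `Ш[2^∞] = 0`).
[cite: HeathBrown1994SelmerCongruentII, Appendix (Monsky), typescript p. 41 L20–L36] [cite: SilvermanAEC2009, Thm. X.4.2] -/
theorem card_selmerGroup_two_congruentNumberCurve_170 : Nat.card ((congruentNumberCurve 170).selmerGroup 2) = 4 :=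
  card_selmerGroup_two_eq_four_of_det_even' ![5, 17] (by simp [Fin.prod_univ_succ]) (by intro i; fin_cases i <;> norm_num) (by intro i; fin_cases i <;> decide) (by decide) det_monskyMatrixEven_170

/-- **`BSD(E_{170}, 2)` WITHOUT Monsky's fact** — journal door {`hBT`, `hH`, `hBF`} only; membership `s(170) = 0` by `det_monskyMatrixEven_170`.
[cite: BurungaleTian2026, Thm. 1.1] [cite: BurungaleFlach2024, Cor. 2] [cite: Miller2011LMS, Def. 1.1] -/
theorem bsdp_two_congruentNumberCurve_170_descent
    (hBT : burungaleTian_analyticRank_eq_zero_of_selmerCorank_eq_zero_of_hasCM)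
    (hH : hasEntireLFunction_of_j_mem_maximalCMJInvariants) (hBF : bsdTriple_of_hasCM_of_L_one_ne_zero) :
    BSDp (congruentNumberCurve 170) 2 :=
  bsdp_two_congruentNumberCurve_of_det_even_descent ![5, 17] hBT hH hBF (by intro i; fin_cases i <;> norm_num) (by intro i; fin_cases i <;> decide) (by decide) det_monskyMatrixEven_170 (by simp [Fin.prod_univ_succ])

/-- **ROLL-UP (even `n`), UNCONDITIONAL**: `#Sel⁽²⁾(E_n/ℚ) = 4` for every even `n ∈ U_CN` with `s(n) = 0`, the list `[2, 10, 26, 42, 58, 66, 74, 106, 114, 122, 130, 170]`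
(12 curves). No named fact. [cite: HeathBrown1994SelmerCongruentII, Appendix (Monsky), typescript p. 41 L20–L36] [cite: SilvermanAEC2009, Thm. X.4.2] -/
theorem card_selmerGroup_two_eq_four_of_mem_evenList :
    ∀ n ∈ ([2, 10, 26, 42, 58, 66, 74, 106, 114, 122, 130, 170] : List ℕ), Nat.card ((congruentNumberCurve n).selmerGroup 2) = 4 := by
  intro n hn
  simp only [List.mem_cons, List.not_mem_nil, or_false] at hn
  rcases hn with rfl | rfl | rfl | rfl | rfl | rfl | rfl | rfl | rfl | rfl | rfl | rfl
  exacts [card_selmerGroup_two_congruentNumberCurve_2, card_selmerGroup_two_congruentNumberCurve_10, card_selmerGroup_two_congruentNumberCurve_26, card_selmerGroup_two_congruentNumberCurve_42, card_selmerGroup_two_congruentNumberCurve_58, card_selmerGroup_two_congruentNumberCurve_66, card_selmerGroup_two_congruentNumberCurve_74, card_selmerGroup_two_congruentNumberCurve_106, card_selmerGroup_two_congruentNumberCurve_114, card_selmerGroup_two_congruentNumberCurve_122, card_selmerGroup_two_congruentNumberCurve_130, card_selmerGroup_two_congruentNumberCurve_170]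

/-- **Rank `0` and `Ш[2^∞] = 0` for these 12 curves, UNCONDITIONALLY** (from `#Sel₂ = 4`: the descent count, Silverman X.4.2).
[cite: SilvermanAEC2009, Thm. X.4.2] [cite: HeathBrown1994SelmerCongruentII, §1 typescript p. 1 L18–L20] -/
theorem rank_zero_sha_two_of_mem_evenList :
    ∀ n ∈ ([2, 10, 26, 42, 58, 66, 74, 106, 114, 122, 130, 170] : List ℕ), ∃ hn : n ≠ 0,
      (haveI := isElliptic_congruentNumberCurve hn; (congruentNumberCurve n).mordellWeilRank = 0) ∧
      (haveI := isElliptic_congruentNumberCurve hn; AddCommGroup.primaryComponent (congruentNumberCurve n).sha 2 = ⊥) := by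
  intro n hn
  have h4 := card_selmerGroup_two_eq_four_of_mem_evenList n hn
  have hn0 : n ≠ 0 := by
    simp only [List.mem_cons, List.not_mem_nil, or_false] at hn
    rcases hn with rfl | rfl | rfl | rfl | rfl | rfl | rfl | rfl | rfl | rfl | rfl | rfl <;> decide
  exact ⟨hn0, Smith2016.mordellWeilRank_eq_zero_of_card_selmerGroup_two hn0 h4,
    Smith2016.primaryComponent_sha_two_eq_bot_of_card_selmerGroup_two hn0 h4⟩

/-- **ROLL-UP (even `n`) WITHOUT Monsky's fact**: `BSD(E_n, 2)` for every even `n ∈ U_CN` with `s(n) = 0` (12 pairs), journal door modulo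
{`hBT`, `hH`, `hBF`} ONLY. [cite: BurungaleTian2026, Thm. 1.1] [cite: BurungaleFlach2024, Cor. 2] [cite: Miller2011LMS, Def. 1.1] -/
theorem bsdp_two_congruentNumberCurve_of_mem_evenList_descent
    (hBT : burungaleTian_analyticRank_eq_zero_of_selmerCorank_eq_zero_of_hasCM)
    (hH : hasEntireLFunction_of_j_mem_maximalCMJInvariants) (hBF : bsdTriple_of_hasCM_of_L_one_ne_zero) :
    ∀ n ∈ ([2, 10, 26, 42, 58, 66, 74, 106, 114, 122, 130, 170] : List ℕ), BSDp (congruentNumberCurve n) 2 := by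
  intro n hn
  simp only [List.mem_cons, List.not_mem_nil, or_false] at hn
  rcases hn with rfl | rfl | rfl | rfl | rfl | rfl | rfl | rfl | rfl | rfl | rfl | rfl
  exacts [bsdp_two_congruentNumberCurve_2_descent hBT hH hBF, bsdp_two_congruentNumberCurve_10_descent hBT hH hBF, bsdp_two_congruentNumberCurve_26_descent hBT hH hBF, bsdp_two_congruentNumberCurve_42_descent hBT hH hBF, bsdp_two_congruentNumberCurve_58_descent hBT hH hBF, bsdp_two_congruentNumberCurve_66_descent hBT hH hBF, bsdp_two_congruentNumberCurve_74_descent hBT hH hBF, bsdp_two_congruentNumberCurve_106_descent hBT hH hBF, bsdp_two_congruentNumberCurve_114_descent hBT hH hBF, bsdp_two_congruentNumberCurve_122_descent hBT hH hBF, bsdp_two_congruentNumberCurve_130_descent hBT hH hBF, bsdp_two_congruentNumberCurve_170_descent hBT hH hBF]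

end Instances

end Summit.BirchSwinnertonDyer.Rank1Residual.P2

end
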